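import Summits.NavierStokesRegularity.NavierStokesRegularity.Theses.QuantisedSymmetry
import Summits.NavierStokesRegularity.NavierStokesRegularity.Theses.Blowup
import Summits.NavierStokesRegularity.NavierStokesRegularity.Theses.DssFarFieldSlaving
import Summits.NavierStokesRegularity.NavierStokesRegularity.Theorems.QuantisedSymmetryPolyhedralDssProfileExistsDominatesBlowupProfile
import Literature.Analysis.FluidPDE.SelfSimilarLiouville
import HarnessLib

/-!
# Strategist census s5 — typed companion (crux `PolyhedralDssProfileExists`, stmt-NavierStokesRegularity-1404)

Independent strategy census, family `s`, seat `cstrat-stmt-NavierStokesRegularity-1404-s5`.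
This file contains NO new mathematics and NO sorries. PUBLICATION NOTE: at publication time the Lean farm could not serve
modules downstream of `Theses.FilamentSkeletonRss` (gate rewrite in progress, `remote:incoherent`), so the two landed bridge
proofs `Theorems.quantisedSymmetry_polyhedralTruncationBridge_proof` (stmt-11331) and `Theorems.dssTruncationBridge_proof`
(stmt-14477) are taken here as HYPOTHESES named `hB` and discharged by name in the docstrings; the evidence copy of this file
attached to stmt-NavierStokesRegularity-1404 (same name, 2026-08-17) imports them and contains the closed forms. It records, kernel-checked:

* the two facts that make the crux summit-strength *in the direction the route uses it*:
  `not_nsr_of_crux : X⁻ → ¬ NavierStokesRegularity` (tree glue `QuantisedSymmetry.closes` fed with the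
  landed bridge `quantisedSymmetry_polyhedralTruncationBridge_proof` and `ClayUniqueness_holds`) and
  `not_nsr_of_blowupProfile : stmt-0155 → ¬ NavierStokesRegularity` (the symmetry-free hub crux already
  decides the summit, via `DssFarFieldSlaving.closes` + `dssTruncationBridge_proof`);
* the chain of STRICTLY-WEAKER intermediates obtained by walking down from the summit,
  `X⁻ → DssProfileExists (W₁) → BlowupTypeIDssProfile (stmt-0155)` and `W₁ → TypeIAncientExists (I₃)`,
  with the census verdict on each recorded in the docstrings (see `STRATEGY-CENSUS-s5.md`);
* the candidate decomposition pieces of the census as `Prop`s (`ApproxDssFamily`, `UniformTypeIBound`,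
  `SymmetrisationStep`), so that "which piece remains the whole crux" is a statement about typed objects.
-/

noncomputable section

namespace Summit.NavierStokesRegularity.NavierStokesRegularity.Cruxes.PolyhedralDssProfileExists.S5

open MeasureTheory
open _root_.Literature.Analysis.FluidPDE

local notation "ℝ³" => EuclideanSpace ℝ (Fin 3)

/-- The crux, by name. -/
abbrev Crux : Prop :=
  _root_.Summit.NavierStokesRegularity.NavierStokesRegularity.Theses.QuantisedSymmetry.PolyhedralDssProfileExists

/-! ## 1. The crux decides the summit (tree theorems only) -/

/-- `X⁻ ⇒ ¬ NSR` is a theorem of the tree: the route glue `closes` with its two non-`X⁻` binders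
discharged by landed proofs (`PolyhedralTruncationBridge`, stmt-11331 — here the hypothesis `hB`, discharged in the tree by
`Theorems.quantisedSymmetry_polyhedralTruncationBridge_proof` — and `ClayUniqueness`, stmt-0153, `ClayUniqueness_holds`). -/
theorem not_nsr_of_crux
    (hB : _root_.Summit.NavierStokesRegularity.NavierStokesRegularity.Theses.QuantisedSymmetry.PolyhedralTruncationBridge)
    (hX : Crux) : ¬ _root_.NavierStokesRegularity :=
  _root_.Summit.NavierStokesRegularity.NavierStokesRegularity.Theses.QuantisedSymmetry.closes hX hB
    _root_.Summit.NavierStokesRegularity.NavierStokesRegularity.Theses.QuantisedSymmetry.ClayUniqueness_holds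

/-- The symmetry-free hub crux stmt-0155 (`BlowupTypeIDssProfile`, wanted by Blowup / DssFarFieldSlaving)
ALREADY decides the summit: `DssFarFieldSlaving.closes` + the landed `dssTruncationBridge_proof` (stmt-14477; here the
hypothesis `hB`). -/
theorem not_nsr_of_blowupProfile
    (hB : _root_.Summit.NavierStokesRegularity.NavierStokesRegularity.Theses.DssFarFieldSlaving.DssTruncationBridge)
    (h : _root_.Summit.NavierStokesRegularity.NavierStokesRegularity.Theses.Blowup.BlowupTypeIDssProfile) :
    ¬ _root_.NavierStokesRegularity := by
  refine _root_.Summit.NavierStokesRegularity.NavierStokesRegularity.Theses.DssFarFieldSlaving.closes hB ?_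
  exact h

/-! ## 2. Weaker intermediates, walking down from the summit -/

/-- **W₁** (drop the symmetry group): a nontrivial Type-I `λ`-DSS ancient mild solution exists for SOME `λ > 1`,
i.e. Tsai's Type-I DSS Liouville statement fails at some factor. Strictly weaker than `X⁻` as typed (no `G`),
strictly stronger than stmt-0155 as typed (no rotation). Census verdict: not a strategy for THIS crux — it is
(one conjunct of) the staffed hub item stmt-0155, and replacing `X⁻` by it is a route re-glue, not a line. -/
def DssProfileExists : Prop :=
  ∃ c : ℝ, 1 < c ∧ ¬ TypeIDSSLiouville c

/-- **I₃** (drop discrete self-similarity as well): a nontrivial Type-I ancient mild solution exists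
(negation of the Type-I ancient Liouville statement `(L_I)`; cf. `Theses.ExtremalTypeIConstant.TypeIAncientLiouville`).
Census verdict: strictly weaker, but it cannot feed `closes`: the only landed truncation bridge
(`filamentSkeletonRss_rdssProfileTruncation_proof`) consumes the period map of a (rotated) DSS solution, and
Albritton–Barker 2019 Thm 1.1 only trades `I₃` for a LOCAL Type-I singularity of a local-energy solution,
not for a finite-energy classical blow-up from a rapidly decaying datum (X5a). -/
def TypeIAncientExists : Prop :=
  ∃ (u : ℝ → ℝ³ → ℝ³) (C₀ : ℝ), IsAncientMildSolution 1 u ∧ (∀ t < 0, AEStronglyMeasurable (u t) volume) ∧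
    HasTypeIDecay C₀ u ∧ ¬ (∀ t < 0, u t =ᵐ[volume] 0)

/-- `X⁻ → W₁` (landed as `exists_not_typeIDSSLiouville_of_polyhedralDssProfileExists`, p156644 family). -/
theorem dssProfileExists_of_crux (hX : Crux) : DssProfileExists :=
  _root_.Summit.NavierStokesRegularity.NavierStokesRegularity.Theorems.PolyhedralDssProfileExists.PolyhedralCell.exists_not_typeIDSSLiouville_of_polyhedralDssProfileExists
    hX

/-- `W₁ → stmt-0155`. -/
theorem blowupProfile_of_dssProfileExists (h : DssProfileExists) :
    _root_.Summit.NavierStokesRegularity.NavierStokesRegularity.Theses.Blowup.BlowupTypeIDssProfile := by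
  obtain ⟨c, -, hc⟩ := h
  dsimp only [_root_.Summit.NavierStokesRegularity.NavierStokesRegularity.Theses.Blowup.BlowupTypeIDssProfile]
  exact fun hL => hc (hL c).1

/-- `W₁ → I₃` (forget the self-similarity of the witness). -/
theorem typeIAncientExists_of_dssProfileExists (h : DssProfileExists) : TypeIAncientExists := by
  obtain ⟨c, hc, hL⟩ := h
  by_contra hI
  apply hL
  intro _ u hanc hmeas _ hdec
  by_contra hnt
  obtain ⟨C₀, hC₀⟩ := hdec
  exact hI ⟨u, C₀, hanc, hmeas, hC₀, hnt⟩

/-- The whole descending chain from the crux: `X⁻ → W₁ ∧ stmt-0155 ∧ I₃`, and (given the landed bridge) `X⁻ → ¬NSR`. -/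
theorem chain_of_crux
    (hB : _root_.Summit.NavierStokesRegularity.NavierStokesRegularity.Theses.QuantisedSymmetry.PolyhedralTruncationBridge)
    (hX : Crux) :
    DssProfileExists ∧
      _root_.Summit.NavierStokesRegularity.NavierStokesRegularity.Theses.Blowup.BlowupTypeIDssProfile ∧
        TypeIAncientExists ∧ ¬ _root_.NavierStokesRegularity :=
  ⟨dssProfileExists_of_crux hX, blowupProfile_of_dssProfileExists (dssProfileExists_of_crux hX),
    typeIAncientExists_of_dssProfileExists (dssProfileExists_of_crux hX), not_nsr_of_crux hB hX⟩

/-! ## 3. Candidate decomposition pieces (typed; census verdicts in the docstrings) -/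

/-- The symmetry package of the crux on a subgroup `G ≤ O(3)`: finite, orientation-preserving, irreducible. -/
def IsPolyhedralGroup (G : Subgroup (ℝ³ ≃ₗᵢ[ℝ] ℝ³)) : Prop :=
  Finite G ∧ (∀ g ∈ G, LinearMap.det (g.toLinearEquiv : ℝ³ →ₗ[ℝ] ℝ³) = 1) ∧
    ∀ V : Submodule ℝ ℝ³, (∀ g ∈ G, ∀ v ∈ V, g v ∈ V) → V = ⊥ ∨ V = ⊤

/-- **Decomposition A3, piece 1** (approximate fixed points of the `G`-renormalisation with a UNIFORM Type-I
constant and a nontriviality floor): for every `ε > 0` a `G`-equivariant Type-I ancient mild solution with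
constant `C₀` (independent of `ε`) which is `ε`-close to its own `λ`-rescaling in the Type-I weighted sup norm
and has modulus `≥ δ` at a fixed space-time point. Piece 2 would be `ApproxDssFamily → Crux` (local compactness
of Type-I ancient mild solutions under the uniform bound: KNSS2009 Prop. 4.1 / Albritton–Barker Lemma 2.2, in
tree as `KNSS2009_prop41_mild_holds`, `SuitableCompactness_holds`). Census verdict: piece 2 is cheap and
`Crux → ApproxDssFamily` is immediate (take the profile itself), so piece 1 IS the crux (costume), violating
"no piece ↔ the crux". -/
def ApproxDssFamily : Prop :=
  ∃ G : Subgroup (ℝ³ ≃ₗᵢ[ℝ] ℝ³), IsPolyhedralGroup G ∧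
    ∃ c : ℝ, 1 < c ∧ ∃ C₀ δ : ℝ, 0 < δ ∧ ∃ t₀ : ℝ, t₀ < 0 ∧ ∃ x₀ : ℝ³, ∀ ε > 0,
      ∃ u : ℝ → ℝ³ → ℝ³, IsAncientMildSolution 1 u ∧ (∀ t < 0, AEStronglyMeasurable (u t) volume) ∧
        HasTypeIDecay C₀ u ∧ (∀ g ∈ G, ∀ t x, u t (g x) = g (u t x)) ∧
          (∀ t < 0, ∀ x, ‖nsRescale c u t x - u t x‖ ≤ ε / (‖x‖ + Real.sqrt (-t))) ∧ δ ≤ ‖u t₀ x₀‖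

/-- **Decomposition A5, piece 1** (the a-priori bound of a Leray–Schauder continuation): the Type-I constants
of all `G`-equivariant `λ`-DSS Type-I ancient mild solutions are bounded by one `C = C(G, λ)`. Typed and
genuinely open (trivially true if the polyhedral Liouville theorem holds; could fail by non-compactness of the
profile set if `X⁻` holds). Piece 2, "the Leray–Schauder index of `I − 𝓡_{G,λ}` on the ball of radius `2C`
is `≠ 1`-compatible with a nontrivial fixed point", is NOT typeable today (the renormalisation map
`𝓡_{G,λ} = 𝒮_λ⁻¹ ∘ Φ_NS(one period)` is not an object of the tree and its domain of definition on a large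
ball is itself a one-period regularity statement) and is where all of the existence content hides.
Census verdict: no registrable split. -/
def UniformTypeIBound : Prop :=
  ∀ G : Subgroup (ℝ³ ≃ₗᵢ[ℝ] ℝ³), IsPolyhedralGroup G → ∀ c : ℝ, 1 < c → ∃ C : ℝ,
    ∀ u : ℝ → ℝ³ → ℝ³, IsAncientMildSolution 1 u → (∀ t < 0, AEStronglyMeasurable (u t) volume) →
      IsDiscretelySelfSimilar c u → (∃ C₀ : ℝ, HasTypeIDecay C₀ u) →
        (∀ g ∈ G, ∀ t x, u t (g x) = g (u t x)) → HasTypeIDecay C u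

/-- **Decomposition via the hub item** `X⁻ ⇐ stmt-0155 ∧ (stmt-0155 → X⁻)`: the second piece
("symmetrisation": from some Type-I (rotated) DSS profile produce a polyhedrally-equivariant one). Census
verdict: a fake split — group-averaging destroys the equation (the nonlinearity is quadratic), no mechanism
in print turns an asymmetric ancient solution into a symmetric one, and the first piece is itself `⊒ ¬NSR`
(`not_nsr_of_blowupProfile` with the landed bridge). -/
def SymmetrisationStep : Prop :=
  _root_.Summit.NavierStokesRegularity.NavierStokesRegularity.Theses.Blowup.BlowupTypeIDssProfile → Crux

/-- The hub split assembles trivially (modus ponens) — recorded only to make explicit that its content is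
entirely in the two pieces, one of which already decides the summit. -/
theorem crux_of_hubSplit
    (h₁ : _root_.Summit.NavierStokesRegularity.NavierStokesRegularity.Theses.Blowup.BlowupTypeIDssProfile)
    (h₂ : SymmetrisationStep) : Crux :=
  h₂ h₁

end Summit.NavierStokesRegularity.NavierStokesRegularity.Cruxes.PolyhedralDssProfileExists.S5

end
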